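import Summits.HubbardSuperconductivity.HubbardLadder.Bounds.StiffnessCeilings
import Literature.MathematicalPhysics.QuantumLattice.MagneticHubbardTorusTrivialField
import HarnessLib

/-!
# Hubbard ladder — Bounds: proof of the x-only kinetic bathtub `KinWeightXCeiling`

HONEST FRAMING (cell pub-hubbard): ladder R1–R4 with certified numbers; no claim on H/H₀. These
are bounds for MODEL CLASSES (finite-range lattice fermions with gauge-invariant interactions);
no materials claim. Companion text: `pub-hubbard/paper/bounds.tex` §2 (Cor. 2.2(i), Remark 2.4),
status table `pub-hubbard/pub-hubbard-bounds/BOUNDS.md`.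

This file CLOSES the last `@[conjecture]` node of
`Summits/HubbardSuperconductivity/HubbardLadder/Bounds/StiffnessCeilings.lean`:

* `kinWeightXCeiling_holds : KinWeightXCeiling` — for EVERY Fock vector `ψ` on the `L × L` torus
  (`L ≥ 3`) and every `ν : ℝ`,
  `K(ψ) ≤ ν Re⟨ψ, N ψ⟩ + 2 ‖ψ‖² Σ_k (cos(2πk₁/L) - ν)⁺`
  (the Lieb–Loss bathtub for the `e₁`-bond kinetic weight alone: the one-body symbol `cos k₁` has
  `L`-fold degenerate levels; optimising `ν` gives the sum of the `⟨N⟩/2` largest values of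
  `cos(2πk₁/L)` counted twice for spin).

Proof: the directional bond graph `dirGraph L i` (`u ∼ v ↔ u = v ± e_i`) is a simple graph on the
fermionic torus whose hopping operator `hopOp (dirGraph L i) σ` is the `e_i`-part of the torus
hopping operator (`hopOp_dirGraph_eq`), so `Σ_σ Re⟨ψ, T^{(i)}_σ ψ⟩ = 2 K_i(ψ)`; its hopping matrix is
diagonalised by the site plane waves with levels `2t cos(2πk_i/L)` (`hopMatrix_dirGraph_eq_conj`,
`charpoly_hopMatrix_dirGraph`, `sum_eigenvalues_hopMatrix_dirGraph`), and the tree's one-body bound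
`FreeKinetic.sum_min_sub_mul_normSq_le` (min-max for `dΓ_σ` of a Hermitian matrix) at potential
`-2ν`, summed over the two spins, is the claim.

References (keys of `lean/references.bib`): HazraVermaRanderia2019 eqs. (2)–(4) (the "single-band
estimate", here a theorem for the x-bond weight); LiebLoss2001 (bathtub principle, Thm 1.14);
ParamekantiTrivediRanderia1998.
-/

noncomputable section

namespace Summit.HubbardSuperconductivity.HubbardLadder.Bounds

open Matrix Finset Real
open Literature.MathematicalPhysics.QuantumLattice
open Literature.MathematicalPhysics.QuantumFieldTheory
open Literature.Probability.LatticeModels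
open Literature.MathematicalPhysics.QuantumLattice.LangerMattis
open Literature.MathematicalPhysics.QuantumLattice.RayleighBound
open scoped ComplexOrder ComplexConjugate

variable {L : ℕ} [NeZero L]

/-- The `e_{i+1}`-bond kinetic weight `K_i(ψ) = Σ_{x,σ} Re⟨ψ, c†_{x+e_i,σ} c_{x,σ} ψ⟩`;
`kinWeightX = bondKinWeight 0` definitionally (`kinWeightX_eq_bondKinWeight_zero`). -/
def bondKinWeight (i : Fin 2) (ψ : Fock (Orb (FermionTorus 2 L))) : ℝ :=
  ∑ x : Site 2 L, ∑ σ : Fin 2,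
    (star ψ ⬝ᵥ ((creation (orb (FermionTorus.ofTorusSite (x + Pi.single i 1)) σ) *
      annihilation (orb (FermionTorus.ofTorusSite x) σ)) *ᵥ ψ)).re

/-- `kinWeightX` is the `e₁`-bond weight (`Site.shift x 0 = x + e₁` by `rfl`). -/
theorem kinWeightX_eq_bondKinWeight_zero (ψ : Fock (Orb (FermionTorus 2 L))) :
    kinWeightX ψ = bondKinWeight 0 ψ :=
  rfl

/-- `max (2a - 2ν) 0 = 2 max (a - ν) 0`. -/
private theorem max_two_mul_sub_two_mul (a ν : ℝ) :
    max (2 * a - 2 * ν) 0 = 2 * max (a - ν) 0 := by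
  rcases le_or_gt ν a with h | h
  · rw [max_eq_left (by linarith), max_eq_left (by linarith)]; ring
  · rw [max_eq_right (by linarith), max_eq_right (by linarith)]; ring

/-! ### The directional bond graph -/

omit [NeZero L] in
/-- `e_i ≠ 0 → (u = u + e_i is impossible)`: cancellation helper. -/
private theorem single_eq_zero_of_eq_add {x : TorusSite 2 L} {i : Fin 2}
    (h : x = x + Pi.single i 1) : (Pi.single i 1 : TorusSite 2 L) = 0 :=
  add_left_cancel ((add_zero x).trans h).symm

variable (L) in
omit [NeZero L] in
/-- The directional bond graph of the fermionic `L × L` torus in direction `e_{i+1}`: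
`u ∼ v` iff `u = v ± e_i` as torus sites (and `e_i ≠ 0`, automatic for `L ≥ 2`, which keeps the
relation irreflexive for every `L`). Its hopping operator `hopOp (dirGraph L i) σ` is the
`e_{i+1}`-part of the torus hopping operator. -/
def dirGraph (i : Fin 2) : SimpleGraph (FermionTorus 2 L) where
  Adj u v := (Pi.single i 1 : TorusSite 2 L) ≠ 0 ∧
    (u.toTorusSite = v.toTorusSite + Pi.single i 1 ∨ v.toTorusSite = u.toTorusSite + Pi.single i 1)
  symm := ⟨fun _ _ h => ⟨h.1, h.2.symm⟩⟩
  loopless := ⟨fun _ h => h.1 (by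
    rcases h.2 with h2 | h2 <;> exact single_eq_zero_of_eq_add h2)⟩

omit [NeZero L] in
/-- Adjacency of `dirGraph`, unfolded. -/
theorem dirGraph_adj (i : Fin 2) (u v : FermionTorus 2 L) :
    (dirGraph L i).Adj u v ↔ (Pi.single i 1 : TorusSite 2 L) ≠ 0 ∧
      (u.toTorusSite = v.toTorusSite + Pi.single i 1 ∨
        v.toTorusSite = u.toTorusSite + Pi.single i 1) :=
  Iff.rfl

/-- Adjacency of `dirGraph L i` is decidable (via `dirGraph_adj`), so that `hopOp`/`hamiltonian` sums over
its bonds elaborate. -/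
instance instDecidableRelDirGraphAdj (i : Fin 2) : DecidableRel (dirGraph L i).Adj :=
  fun u v => decidable_of_iff _ (dirGraph_adj i u v).symm

/-- Adjacency of `dirGraph` on torus sites (`L ≥ 2`): `x ∼ z ↔ z = x - e_i ∨ z = x + e_i`. -/
theorem dirGraph_adj_ofTorusSite_iff (hL : 2 ≤ L) (i : Fin 2) (x z : TorusSite 2 L) :
    (dirGraph L i).Adj (FermionTorus.ofTorusSite x) (FermionTorus.ofTorusSite z) ↔
      z = x - Pi.single i 1 ∨ z = x + Pi.single i 1 := by
  rw [dirGraph_adj, FermionTorus.toTorusSite_ofTorusSite, FermionTorus.toTorusSite_ofTorusSite,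
    and_iff_right (torusUnit_ne_zero hL i), eq_sub_iff_add_eq]
  constructor
  · rintro (h | h)
    · exact Or.inl h.symm
    · exact Or.inr h
  · rintro (h | h)
    · exact Or.inl h.symm
    · exact Or.inr h

omit [NeZero L] in
/-- `x - e_i ≠ x + e_i` on `(ℤ/L)²` for `L ≥ 3` (`2 e_i ≠ 0`). -/
private theorem sub_single_ne_add_single (hL : 3 ≤ L) (i : Fin 2) (x : TorusSite 2 L) :
    x - Pi.single i 1 ≠ x + Pi.single i 1 := by
  intro h
  have h2 : x = x + (Pi.single i 1 + Pi.single i 1) :=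
    (sub_eq_iff_eq_add.mp h).trans (add_assoc _ _ _)
  exact torusUnit_add_torusUnit_ne_zero hL i i (add_left_cancel ((add_zero x).trans h2).symm)

/-- A sum over `{p, q}` written with an indicator, `p ≠ q`. -/
private theorem sum_ite_eq_or {M : Type*} [AddCommMonoid M] {p q : TorusSite 2 L} (hpq : p ≠ q)
    (g : TorusSite 2 L → M) :
    (∑ z, if z = p ∨ z = q then g z else 0) = g p + g q := by
  have key : ∀ z, (if z = p ∨ z = q then g z else 0) =
      (if z = p then g z else 0) + (if z = q then g z else 0) := by
    intro z
    by_cases hp : z = p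
    · subst hp
      simp [hpq]
    · by_cases hq : z = q
      · subst hq
        simp [hp]
      · simp [hp, hq]
  simp_rw [key, Finset.sum_add_distrib, Finset.sum_ite_eq', Finset.mem_univ, if_true]

/-- **The directional hopping operator as a bond sum** (`L ≥ 3`):
`hopOp (dirGraph L i) σ = Σ_x (c†_{x+e_i,σ} c_{x,σ} + c†_{x,σ} c_{x+e_i,σ})`. -/
theorem hopOp_dirGraph_eq (hL : 3 ≤ L) (i σ : Fin 2) :
    hopOp (dirGraph L i) σ =
      ∑ x : Site 2 L,
        (creation (orb (FermionTorus.ofTorusSite (x + Pi.single i 1)) σ) *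
            annihilation (orb (FermionTorus.ofTorusSite x) σ) +
          creation (orb (FermionTorus.ofTorusSite x) σ) *
            annihilation (orb (FermionTorus.ofTorusSite (x + Pi.single i 1)) σ)) := by
  have hL2 : 2 ≤ L := by omega
  set F : TorusSite 2 L → TorusSite 2 L →
      Matrix (Finset (Orb (FermionTorus 2 L))) (Finset (Orb (FermionTorus 2 L))) ℂ :=
    fun x z => creation (orb (FermionTorus.ofTorusSite x) σ) *
      annihilation (orb (FermionTorus.ofTorusSite z) σ) with hF
  have hre : ∑ x : TorusSite 2 L, F x (x - Pi.single i 1) =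
      ∑ x : TorusSite 2 L, F (x + Pi.single i 1) x :=
    Fintype.sum_equiv (Equiv.subRight (Pi.single i (1 : ZMod L) : TorusSite 2 L)) _ _ fun x => by
      simp only [Equiv.subRight_apply, sub_add_cancel]
  calc hopOp (dirGraph L i) σ
      = ∑ x : TorusSite 2 L, ∑ z : TorusSite 2 L,
          if z = x - Pi.single i 1 ∨ z = x + Pi.single i 1 then F x z else 0 := by
        unfold hopOp
        rw [FermionTorus.sum_eq_sum_torusSite]
        refine Finset.sum_congr rfl fun x _ => ?_
        rw [FermionTorus.sum_eq_sum_torusSite]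
        refine Finset.sum_congr rfl fun z _ => ?_
        simp only [dirGraph_adj_ofTorusSite_iff hL2, hF]
    _ = ∑ x : TorusSite 2 L, (F x (x - Pi.single i 1) + F x (x + Pi.single i 1)) :=
        Finset.sum_congr rfl fun x _ => sum_ite_eq_or (sub_single_ne_add_single hL i x) _
    _ = ∑ x : TorusSite 2 L, F (x + Pi.single i 1) x +
          ∑ x : TorusSite 2 L, F x (x + Pi.single i 1) := by
        rw [Finset.sum_add_distrib, hre]
    _ = _ := by
        rw [← Finset.sum_add_distrib]

/-- `Re⟨ψ, T^{(i)}_σ ψ⟩ = 2 Σ_x Re⟨ψ, c†_{x+e_i,σ} c_{x,σ} ψ⟩`. -/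
theorem re_hopOp_dirGraph_eq (hL : 3 ≤ L) (i σ : Fin 2) (ψ : Fock (Orb (FermionTorus 2 L))) :
    (star ψ ⬝ᵥ (hopOp (dirGraph L i) σ *ᵥ ψ)).re =
      2 * ∑ x : Site 2 L,
        (star ψ ⬝ᵥ ((creation (orb (FermionTorus.ofTorusSite (x + Pi.single i 1)) σ) *
          annihilation (orb (FermionTorus.ofTorusSite x) σ)) *ᵥ ψ)).re := by
  rw [hopOp_dirGraph_eq hL i σ]
  simp only [Matrix.sum_mulVec, dotProduct_sum, Complex.re_sum, Matrix.add_mulVec, dotProduct_add,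
    Complex.add_re, Finset.mul_sum]
  refine Finset.sum_congr rfl fun x _ => ?_
  rw [star_dotProduct_creation_mul_annihilation_mulVec_swap
      (orb (FermionTorus.ofTorusSite (x + Pi.single i 1)) σ) (orb (FermionTorus.ofTorusSite x) σ) ψ,
    Complex.conj_re]
  ring

/-- `Σ_σ Re⟨ψ, T^{(i)}_σ ψ⟩ = 2 K_i(ψ)`. -/
theorem sum_re_hopOp_dirGraph_eq (hL : 3 ≤ L) (i : Fin 2) (ψ : Fock (Orb (FermionTorus 2 L))) :
    ∑ σ : Fin 2, (star ψ ⬝ᵥ (hopOp (dirGraph L i) σ *ᵥ ψ)).re = 2 * bondKinWeight i ψ := by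
  simp only [re_hopOp_dirGraph_eq hL, bondKinWeight]
  rw [← Finset.mul_sum, Finset.sum_comm]

omit [NeZero L] in
/-- `Σ_σ Σ_x n_{xσ} = N` (reordering). -/
theorem sum_sum_numberOp_eq_totalNumber :
    ∑ σ : Fin 2, ∑ x : FermionTorus 2 L, numberOp x σ =
      (totalNumber :
        Matrix (Finset (Orb (FermionTorus 2 L))) (Finset (Orb (FermionTorus 2 L))) ℂ) := by
  rw [Finset.sum_comm]; rfl

omit [NeZero L] in
/-- `Σ_σ Re⟨ψ, N_σ ψ⟩ = Re⟨ψ, N ψ⟩` for every Fock vector. -/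
theorem sum_re_numberOp_eq_re_totalNumber (ψ : Fock (Orb (FermionTorus 2 L))) :
    ∑ σ : Fin 2, (star ψ ⬝ᵥ ((∑ x : FermionTorus 2 L, numberOp x σ) *ᵥ ψ)).re =
      (star ψ ⬝ᵥ (totalNumber *ᵥ ψ)).re := by
  rw [← Complex.re_sum, ← dotProduct_sum, ← Matrix.sum_mulVec, sum_sum_numberOp_eq_totalNumber]

/-! #### Plane waves diagonalise the directional hopping matrix -/

/-- **`A^{(i)} W = W diag(2t cos(2πk_i/L))`**: the site plane waves are eigenvectors of the
directional hopping matrix (`L ≥ 3`). -/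
theorem hopMatrix_dirGraph_mul_sitePlaneWave (hL : 3 ≤ L) (i : Fin 2) (t : ℝ) :
    hopMatrix (dirGraph L i) t * sitePlaneWave 2 L =
      sitePlaneWave 2 L *
        diagonal (fun k => ((t * (2 * Real.cos (latticeMomentum L k.toTorusSite i)) : ℝ) : ℂ)) := by
  have hL2 : 2 ≤ L := by omega
  ext x k
  rw [Matrix.mul_apply, mul_diagonal]
  simp only [hopMatrix, sitePlaneWave, Matrix.of_apply, ite_mul, zero_mul]
  rw [FermionTorus.sum_eq_sum_torusSite]
  obtain ⟨a, rfl⟩ : ∃ a : TorusSite 2 L, FermionTorus.ofTorusSite a = x :=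
    ⟨x.toTorusSite, FermionTorus.ofTorusSite_toTorusSite x⟩
  simp only [FermionTorus.toTorusSite_ofTorusSite, dirGraph_adj_ofTorusSite_iff hL2]
  rw [sum_ite_eq_or (sub_single_ne_add_single hL i a), torusChar_sub_right, torusChar_add_right,
    Complex.ofReal_mul, ← torusChar_single_add_conj hL2 k.toTorusSite i]
  ring

/-- `A^{(i)} = W diag Wᴴ`. -/
theorem hopMatrix_dirGraph_eq_conj (hL : 3 ≤ L) (i : Fin 2) (t : ℝ) :
    hopMatrix (dirGraph L i) t =
      sitePlaneWave 2 L *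
          diagonal (fun k => ((t * (2 * Real.cos (latticeMomentum L k.toTorusSite i)) : ℝ) : ℂ)) *
        (sitePlaneWave 2 L)ᴴ := by
  rw [← hopMatrix_dirGraph_mul_sitePlaneWave hL i t, Matrix.mul_assoc,
    sitePlaneWave_mul_conjTranspose, Matrix.mul_one]

/-- The characteristic polynomial of the directional hopping matrix: `∏_k (X - 2t cos(2πk_i/L))`. -/
theorem charpoly_hopMatrix_dirGraph (hL : 3 ≤ L) (i : Fin 2) (t : ℝ) :
    (hopMatrix (dirGraph L i) t).charpoly =
      ∏ k : FermionTorus 2 L,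
        (Polynomial.X -
          Polynomial.C (((t * (2 * Real.cos (latticeMomentum L k.toTorusSite i))) : ℝ) : ℂ)) := by
  rw [hopMatrix_dirGraph_eq_conj hL i t,
    Literature.Computability.AlgebraicComplexity.charpoly_conj_of_mul_eq_one _ _ _
      conjTranspose_sitePlaneWave_mul,
    Matrix.charpoly_diagonal]

/-- **Spectral sums of the directional hopping matrix are momentum sums**:
`Σ_j f(λ_j(t A^{(i)})) = Σ_k f(2t cos(2πk_i/L))` (`L ≥ 3`; each level `L`-fold degenerate). -/
theorem sum_eigenvalues_hopMatrix_dirGraph (hL : 3 ≤ L) (i : Fin 2) (t : ℝ) (f : ℝ → ℝ) :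
    ∑ j, f ((isHermitian_hopMatrix (dirGraph L i) t).eigenvalues j) =
      ∑ k : TorusSite 2 L, f (t * (2 * Real.cos (latticeMomentum L k i))) := by
  rw [Literature.Computability.AlgebraicComplexity.sum_eigenvalues_eq_roots_sum _ f,
    charpoly_hopMatrix_dirGraph hL i t,
    Literature.Computability.AlgebraicComplexity.roots_prod_X_sub_C_fun, Multiset.map_map,
    ← Finset.sum_eq_multiset_sum, FermionTorus.sum_eq_sum_torusSite]
  refine Finset.sum_congr rfl fun z _ => ?_
  simp only [Function.comp_apply, RCLike.re_to_complex, Complex.ofReal_re,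
    FermionTorus.toTorusSite_ofTorusSite]

/-! #### The directional dual bathtub and the proof of `KinWeightXCeiling` -/

/-- `min (-1·a - (-ν)) 0 = -max (a - ν) 0`. -/
private theorem min_neg_one_mul_sub_neg' (a ν : ℝ) : min (-1 * a - -ν) 0 = -max (a - ν) 0 := by
  rcases le_or_gt ν a with h | h
  · rw [max_eq_left (sub_nonneg.2 h), min_eq_left (by linarith)]; ring
  · rw [max_eq_right (sub_nonpos.2 h.le), min_eq_right (by linarith)]; ring

/-- **Directional dual bathtub**: for `L ≥ 3`, every spin `σ`, `ν : ℝ` and Fock vector `ψ`,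
`Re⟨ψ, T^{(i)}_σ ψ⟩ ≤ ν Re⟨ψ, N_σ ψ⟩ + ‖ψ‖² Σ_k (2 cos(2πk_i/L) - ν)⁺`. -/
theorem re_hopOp_dirGraph_le (hL : 3 ≤ L) (i σ : Fin 2) (ν : ℝ)
    (ψ : Fock (Orb (FermionTorus 2 L))) :
    (star ψ ⬝ᵥ (hopOp (dirGraph L i) σ *ᵥ ψ)).re ≤
      ν * (star ψ ⬝ᵥ ((∑ x : FermionTorus 2 L, numberOp x σ) *ᵥ ψ)).re +
        (∑ k : TorusSite 2 L, max (2 * Real.cos (latticeMomentum L k i) - ν) 0) * normSq ψ := by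
  have h :=
    FreeKinetic.sum_min_sub_mul_normSq_le σ (isHermitian_hopMatrix (dirGraph L i) (-1)) (-ν) ψ
  have hR : (star ψ ⬝ᵥ (dGammaSpin σ (hopMatrix (dirGraph L i) (-1)) *ᵥ ψ)).re =
      -(star ψ ⬝ᵥ (hopOp (dirGraph L i) σ *ᵥ ψ)).re := by
    rw [FreeKinetic.dGammaSpin_hopMatrix, Matrix.smul_mulVec, dotProduct_smul, smul_eq_mul]
    simp
  have h2 : ∑ j, min ((isHermitian_hopMatrix (dirGraph L i) (-1)).eigenvalues j - -ν) 0 =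
      ∑ k : TorusSite 2 L, min (-1 * (2 * Real.cos (latticeMomentum L k i)) - -ν) 0 :=
    sum_eigenvalues_hopMatrix_dirGraph hL i (-1) (fun x => min (x - -ν) 0)
  have hS : ∑ k : TorusSite 2 L, min (-1 * (2 * Real.cos (latticeMomentum L k i)) - -ν) 0 =
      -∑ k : TorusSite 2 L, max (2 * Real.cos (latticeMomentum L k i) - ν) 0 := by
    rw [← Finset.sum_neg_distrib]
    exact Finset.sum_congr rfl fun k _ => min_neg_one_mul_sub_neg' _ _
  have h' : (-∑ k : TorusSite 2 L, max (2 * Real.cos (latticeMomentum L k i) - ν) 0) * normSq ψ +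
        -ν * (star ψ ⬝ᵥ ((∑ x : FermionTorus 2 L, numberOp x σ) *ᵥ ψ)).re ≤
      -(star ψ ⬝ᵥ (hopOp (dirGraph L i) σ *ᵥ ψ)).re := by
    calc (-∑ k : TorusSite 2 L, max (2 * Real.cos (latticeMomentum L k i) - ν) 0) * normSq ψ +
          -ν * (star ψ ⬝ᵥ ((∑ x : FermionTorus 2 L, numberOp x σ) *ᵥ ψ)).re
        = (∑ j, min ((isHermitian_hopMatrix (dirGraph L i) (-1)).eigenvalues j - -ν) 0) * normSq ψ +
          -ν * (star ψ ⬝ᵥ ((∑ x : FermionTorus 2 L, numberOp x σ) *ᵥ ψ)).re := by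
          rw [h2, hS]
      _ ≤ (star ψ ⬝ᵥ (dGammaSpin σ (hopMatrix (dirGraph L i) (-1)) *ᵥ ψ)).re := h
      _ = -(star ψ ⬝ᵥ (hopOp (dirGraph L i) σ *ᵥ ψ)).re := hR
  linarith [h']

/-- **Proof of `KinWeightXCeiling`** (bounds.tex Cor. 2.2(i) at `t' = 0`): for every Fock vector `ψ`
on the `L × L` torus (`L ≥ 3`) and every `ν`,
`K(ψ) ≤ ν Re⟨ψ, N ψ⟩ + 2 ‖ψ‖² Σ_k (cos(2πk₁/L) - ν)⁺`. -/
theorem kinWeightXCeiling_holds : KinWeightXCeiling := by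
  intro L _ hL ψ ν
  have hσ : ∀ σ : Fin 2, (star ψ ⬝ᵥ (hopOp (dirGraph L 0) σ *ᵥ ψ)).re ≤
      (2 * ν) * (star ψ ⬝ᵥ ((∑ x : FermionTorus 2 L, numberOp x σ) *ᵥ ψ)).re +
        (2 * ∑ k : TorusSite 2 L, max (Real.cos (latticeMomentum L k 0) - ν) 0) * normSq ψ := by
    intro σ
    have h := re_hopOp_dirGraph_le hL 0 σ (2 * ν) ψ
    have hS : ∑ k : TorusSite 2 L, max (2 * Real.cos (latticeMomentum L k 0) - 2 * ν) 0 =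
        2 * ∑ k : TorusSite 2 L, max (Real.cos (latticeMomentum L k 0) - ν) 0 := by
      rw [Finset.mul_sum]
      exact Finset.sum_congr rfl fun k _ => max_two_mul_sub_two_mul _ _
    rwa [hS] at h
  have hsum := Finset.sum_le_sum fun σ (_ : σ ∈ (Finset.univ : Finset (Fin 2))) => hσ σ
  rw [sum_re_hopOp_dirGraph_eq hL 0 ψ, Finset.sum_add_distrib, ← Finset.mul_sum,
    sum_re_numberOp_eq_re_totalNumber ψ] at hsum
  simp only [Finset.sum_const, Finset.card_univ, Fintype.card_fin, nsmul_eq_mul, Nat.cast_ofNat]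
    at hsum
  rw [kinWeightX_eq_bondKinWeight_zero]
  linarith

end Summit.HubbardSuperconductivity.HubbardLadder.Bounds

end
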